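/-
Copyright (c) 2026. Released under Apache 2.0 license.
-/
import Literature.NumberTheory.Automorphic.UnboundedDenominatorsLayerCoordinatesMul
import HarnessLib

/-!
# The invariant `ℤ/2`-character of `Γ(N)` for even `N`, with its evaluation rule

For even `N` the map `θ₂ : Γ(N) → ℤ/2`, `θ₂(1 + NX) = X₀₀ + X₀₁ + X₁₀ (mod 2)`, is an `SL₂(ℤ)`-conjugation-invariant
homomorphism, trivial on `Γ(2N)` (it detects Beyl's `ℤ/2 = M(SL₂(ℤ/N))` when `4 ∣ N`, [Beyl1986]).  This file
re-derives it from the layer coordinates `Γ(N)/Γ(2N) ≅ 𝔰𝔩₂(𝔽₂)` and — unlike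
`UnboundedDenominatorsCommutatorLevelBound.exists_invariant_hom_of_even` — exports the evaluation rule, which the
`2`-adic depth step of the invariant form of [CalegariDimitrovTang2025, Corollary 4.5.3] needs.
-/

open scoped MatrixGroups

namespace Literature.NumberTheory.Automorphic

namespace UnboundedDenominators

open CongruenceSubgroup Matrix.SpecialLinearGroup ModularGroup

/-- The `𝔽₂`-identity behind the invariance of `θ₂`: the sum of the coordinates of `Ad(g)X` equals the sum
of the coordinates of `X` when `det g = 1`. [folklore] -/
private theorem sum_ad_eq (a b c d α β κ : ZMod 2) (hdet : a * d - b * c = 1) :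
    ((a * d + b * c) * α + b * d * κ - a * c * β) + (a ^ 2 * β - b ^ 2 * κ - 2 * a * b * α) +
      (d ^ 2 * κ - c ^ 2 * β + 2 * c * d * α) = α + β + κ := by
  revert a b c d α β κ
  decide

/-- Entries of an element of `Γ(M)`. [folklore] -/
private theorem exists_entries_eq₃ {M : ℕ} {x : SL(2, ℤ)} (hx : x ∈ Gamma M) :
    ∃ α β κ δ : ℤ, (x 0 0 : ℤ) = 1 + M * α ∧ (x 0 1 : ℤ) = M * β ∧ (x 1 0 : ℤ) = M * κ ∧
      (x 1 1 : ℤ) = 1 + M * δ := by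
  obtain ⟨h00, h01, h10, h11⟩ := Gamma_mem.mp hx
  obtain ⟨α, hα⟩ := (ZMod.intCast_eq_intCast_iff_dvd_sub 1 (x 0 0) M).mp (by simpa using h00.symm)
  obtain ⟨β, hβ⟩ := (ZMod.intCast_zmod_eq_zero_iff_dvd _ M).mp h01
  obtain ⟨κ, hκ⟩ := (ZMod.intCast_zmod_eq_zero_iff_dvd _ M).mp h10
  obtain ⟨δ, hδ⟩ := (ZMod.intCast_eq_intCast_iff_dvd_sub 1 (x 1 1) M).mp (by simpa using h11.symm)
  exact ⟨α, β, κ, δ, by linear_combination hα, hβ, hκ, by linear_combination hδ⟩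

/-- **The invariant character at `2`, with its evaluation rule.**  For even `N ≠ 0` there is an
`SL₂(ℤ)`-conjugation-invariant homomorphism `θ₂ : Γ(N) → ℤ/2`, trivial on `Γ(2N)`, with
`θ₂(x) = α + β + κ (mod 2)` whenever `x₀₀ = 1 + Nα`, `x₀₁ = Nβ`, `x₁₀ = Nκ`.
[cite: Beyl1986, Theorem] [cite: CalegariDimitrovTang2025, Corollary 4.5.3] -/
theorem exists_invariant_twoChar {N : ℕ} (hN : N ≠ 0) (h2 : 2 ∣ N) :
    ∃ θ₂ : Gamma N →* Multiplicative (ZMod 2),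
      (∀ (g x : SL(2, ℤ)) (hx : x ∈ Gamma N) (hgx : g * x * g⁻¹ ∈ Gamma N),
        θ₂ ⟨g * x * g⁻¹, hgx⟩ = θ₂ ⟨x, hx⟩) ∧
      (∀ (x : SL(2, ℤ)) (hx : x ∈ Gamma N), x ∈ Gamma (N * 2) → θ₂ ⟨x, hx⟩ = 1) ∧
      (∀ (x : SL(2, ℤ)) (hx : x ∈ Gamma N) (α β κ : ℤ), (x 0 0 : ℤ) = 1 + N * α → (x 0 1 : ℤ) = N * β →
        (x 1 0 : ℤ) = N * κ → θ₂ ⟨x, hx⟩ = Multiplicative.ofAdd (((α + β + κ : ℤ) : ZMod 2))) := by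
  obtain ⟨Φ, P1, P2, -, P4, -, -, -⟩ := exists_layerCoord_mul N 2 hN h2
  -- the sum of the coordinates
  let σ : Multiplicative (ZMod 2 × ZMod 2 × ZMod 2) →* Multiplicative (ZMod 2) :=
    AddMonoidHom.toMultiplicative
      ((AddMonoidHom.fst (ZMod 2) (ZMod 2 × ZMod 2)) +
        ((AddMonoidHom.fst (ZMod 2) (ZMod 2)).comp (AddMonoidHom.snd (ZMod 2) (ZMod 2 × ZMod 2))) +
        ((AddMonoidHom.snd (ZMod 2) (ZMod 2)).comp (AddMonoidHom.snd (ZMod 2) (ZMod 2 × ZMod 2))))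
  have hσ : ∀ a b c : ZMod 2, σ (Multiplicative.ofAdd (a, b, c)) = Multiplicative.ofAdd (a + b + c) := by
    intro a b c; rfl
  refine ⟨σ.comp Φ, ?_, ?_, ?_⟩
  · intro g x hx hgx
    obtain ⟨α, β, κ, δ, ha, hb, hc, hd⟩ := exists_entries_eq₃ hx
    have hΦx := P1 x hx α β κ ha hb hc
    have hΦg := P4 g x hx hgx _ _ _ hΦx
    rw [MonoidHom.comp_apply, MonoidHom.comp_apply, hΦg, hΦx, hσ, hσ]
    congr 1
    have hdet : ((g 0 0 : ℤ) : ZMod 2) * (g 1 1 : ℤ) - ((g 0 1 : ℤ) : ZMod 2) * (g 1 0 : ℤ) = 1 := by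
      have h := det_coe g
      rw [Matrix.det_fin_two] at h
      have h' := congrArg (fun z : ℤ ↦ (z : ZMod 2)) h
      push_cast at h'
      exact h'
    exact sum_ad_eq _ _ _ _ _ _ _ hdet
  · intro x hx hx2
    rw [MonoidHom.comp_apply, P2 x hx hx2, map_one]
  · intro x hx α β κ ha hb hc
    rw [MonoidHom.comp_apply, P1 x hx α β κ ha hb hc, hσ]
    push_cast
    rfl

end UnboundedDenominators

end Literature.NumberTheory.Automorphic
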